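import Summits.NavierStokesRegularity.NavierStokesRegularity.Theorems.CriticalCoherenceDoor
import Literature.Analysis.FluidPDE.BKMClassPointwiseBlowup
import Literature.Analysis.FluidPDE.BKMClassVorticitySupLipschitz
import Literature.Analysis.FluidPDE.VorticityDirectionDynamics
import Literature.Analysis.FluidPDE.VorticityDirectionDepletion
import HarnessLib

/-!
# ArgmaxDoorsDefs — door family S35 «ArgmaxDoors» (argmax engine): texts of record + compositions (plate P0)
Texts of record: nsreg-p1 g29 `r33/Sketch35.lean` v3 sha16 93168f45ce53c5c4 (ROUND-33; bc7 CLEAN); EVERY DECLARATION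
BYTE-IDENTICAL (the sketch's 34-line module docstring is condensed here for the 400-line cap — read it in the sketch /
ROUND-33.md; one missing decl docstring added); landed by ns-s29-p2 g4 on p1 g29's word 15:22:50Z (3) / LEAD ns-s30-p1 g3,
`--supports stmt-NavierStokesRegularity-0056 --as helper`.  Texts: doors `ArgmaxIntegralDoor`/`ArgmaxSubcriticalDoor`/
`ArgmaxCoherenceDoor`; plates `ArgmaxEngine`, `PhaseLemma`, `TypeISmallFloor` (PROVED via S33), `PointDepletion`; compositions
kernel-checked.  WHAT THIS IS NOT: regularity CRITERIA about hypothetical blow-up; 0056 `NoTypeII` / NS regularity NOT proved.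
-/

noncomputable section

open MeasureTheory Set Function Filter Metric Real InnerProductSpace
open _root_.Topology
open scoped ENNReal NNReal RealInnerProductSpace ContDiff
open Literature.Analysis.FluidPDE
open Summit.NavierStokesRegularity.NavierStokesRegularity.Theorems.CriticalCoherenceDoor
  (CriticalCoherence CriticalCoherenceDoor criticalCoherenceDoor_holds)

set_option linter.dupNamespace false

namespace Summit.NavierStokesRegularity.NavierStokesRegularity.Theorems.ArgmaxDoors

-- nested operator types (second derivatives)
set_option maxSynthPendingDepth 3

/-! ## §0 One-point quantities -/

/-- support (definition): `x` is a (global) vorticity argmax at time `t`: `|ω(y,t)| ≤ |ω(x,t)|` for all `y`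
(`ω = curl u`). -/
def IsVorticityArgmax (u : ℝ → (EuclideanSpace ℝ (Fin 3)) → (EuclideanSpace ℝ (Fin 3))) (t : ℝ)
    (x : EuclideanSpace ℝ (Fin 3)) : Prop :=
  ∀ y, ‖curl (u t) y‖ ≤ ‖curl (u t) x‖

/-- support (definition): `‖ω(t)‖_∞` as a real number (the tree's spelling, `BKMClassVorticitySupLipschitz`). -/
def supVorticity (u : ℝ → (EuclideanSpace ℝ (Fin 3)) → (EuclideanSpace ℝ (Fin 3))) (t : ℝ) : ℝ :=
  (⨆ x, ‖curl (u t) x‖ₑ).toReal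

/-- support (definition): the TWIST-CREDITED STRETCHING (net amplification numerator) at `(t,x)`:
`⟪ω, (∇u)ω⟫ − ν|ω|²|∇ξ|²_F = |ω|²·(α − ν|∇ξ|²_F)`, `α = ⟪ξ,(∇u)ξ⟫`, `ξ = ω/|ω|` (the tree's junk-free
`vorticityDirection`), `|·|²_F = frobeniusNormSq`. -/
def netStretch (ν : ℝ) (u : ℝ → (EuclideanSpace ℝ (Fin 3)) → (EuclideanSpace ℝ (Fin 3))) (t : ℝ)
    (x : EuclideanSpace ℝ (Fin 3)) : ℝ :=
  ⟪curl (u t) x, fderiv ℝ (u t) x (curl (u t) x)⟫ -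
    ν * ‖curl (u t) x‖ ^ 2 * frobeniusNormSq (fderiv ℝ (vorticityDirection (curl (u t))) x)

/-- support (definition): the DEPLETION INTEGRAL seen from `x` at time `t`:
`∫ |ω(y) − ⟪ω(y), ξ(x)⟫ξ(x)| · |x − y|⁻³ dy = ∫ |ω(y)| sin∠(ω(y), ξ(x)) |x − y|⁻³ dy` (the
majorant of Constantin–Fefferman's kernel `D(ŷ, ξ(y), ξ(x))|ω(y)||y−x|⁻³`; finite for a classical slice
with `ω(x) ≠ 0`: the sine is Lipschitz near `x`, `ω ∈ L²` far away). -/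
def depletionIntegral (u : ℝ → (EuclideanSpace ℝ (Fin 3)) → (EuclideanSpace ℝ (Fin 3))) (t : ℝ)
    (x : EuclideanSpace ℝ (Fin 3)) : ℝ :=
  ∫ y, ‖curl (u t) y - ⟪curl (u t) y, vorticityDirection (curl (u t)) x⟫ •
      vorticityDirection (curl (u t)) x‖ * (‖x - y‖ ^ 3)⁻¹

/-! ## §1 Door S35-A «ArgmaxIntegralDoor» -/

/-- door S35-A «ArgmaxIntegralDoor» (regularity criterion; BKM at the argmax, twist-credited; type-blind).
`ν > 0`, `0 ≤ t₀ < T`, `(u,p)` a classical unforced Navier–Stokes solution on `ℝ³ × [0,T)` with all `L²`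
Sobolev seminorms bounded on every `[0,T'']`, `T'' < T` (the frame of S33/S34). If some `Φ`, continuous
on `[t₀,T)` with one-sided derivative `φ(t)` (within `[t₀,T)`) and BOUNDED ABOVE (`Φ ≤ C`), has a
derivative dominating the twist-credited stretching at EVERY vorticity argmax —
`⟪ω,(∇u)ω⟫ − ν|ω|²|∇ξ|²_F ≤ φ(t)|ω|²` at `(x̄,t)` — then `u` continues in the Sobolev class past `T`.
(BKM reads `∫^T ‖ω‖_∞ < ∞`; here only the primitive of the NET RATE AT THE ARGMAX must stay bounded
above: `α(x̄)` may be positive and non-integrable against a compensating twist `ν|∇ξ(x̄)|²_F`, and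
nothing away from the argmax is charged. `φ` continuous ⇒ take `Φ = ∫_{t₀} φ`.) -/
def ArgmaxIntegralDoor : Prop :=
  ∀ (ν T t₀ C : ℝ) (Φ φ : ℝ → ℝ), 0 < ν → 0 ≤ t₀ → t₀ < T → ContinuousOn Φ (Ico t₀ T) →
    (∀ t ∈ Ico t₀ T, HasDerivWithinAt Φ (φ t) (Ico t₀ T) t) → (∀ t ∈ Ico t₀ T, Φ t ≤ C) →
    ∀ (u : ℝ → (EuclideanSpace ℝ (Fin 3)) → (EuclideanSpace ℝ (Fin 3)))
      (p : ℝ → (EuclideanSpace ℝ (Fin 3)) → ℝ),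
      IsClassicalNSSolutionOn (Ico 0 T) ν 0 u p →
      (∀ T'' < T, HasBoundedSobolevNormsOn (Icc 0 T'') u) →
      (∀ t ∈ Ico t₀ T, ∀ x, IsVorticityArgmax u t x → netStretch ν u t x ≤ φ t * ‖curl (u t) x‖ ^ 2) →
      HasSobolevExtensionPast ν u T

/-! ## §2 Door S35-B «ArgmaxSubcriticalDoor» -/

/-- door S35-B «ArgmaxSubcriticalDoor» (regularity criterion; critical rate, threshold ONE). `ν > 0`,
`0 ≤ t₀ < T`, `a < 1`, `0 < ε < √3/4`, `(u,p)` in the frame. If at every late time `t ∈ [t₀,T)` and every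
vorticity argmax `x̄` lying in the scale-critical regime `(T − t)|ω(x̄,t)| > ε` (i.e. `(T−t)‖ω(t)‖_∞ > ε`)
the twist-credited stretching is `a`-subcritical — `(T − t)·(⟪ω,(∇u)ω⟫ − ν|ω|²|∇ξ|²_F) ≤ a|ω|²` at
`(x̄,t)` — then `u` continues in the Sobolev class past `T`. The stretching `α(x̄)` itself may exceed
`1/(T−t)` by any amount the twist `ν|∇ξ(x̄)|²_F` pays for; `a = 1` is the self-similar rate and is NOT
covered. -/
def ArgmaxSubcriticalDoor : Prop :=
  ∀ (ν T t₀ a ε : ℝ), 0 < ν → 0 ≤ t₀ → t₀ < T → a < 1 → 0 < ε → ε < Real.sqrt 3 / 4 →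
    ∀ (u : ℝ → (EuclideanSpace ℝ (Fin 3)) → (EuclideanSpace ℝ (Fin 3)))
      (p : ℝ → (EuclideanSpace ℝ (Fin 3)) → ℝ),
      IsClassicalNSSolutionOn (Ico 0 T) ν 0 u p →
      (∀ T'' < T, HasBoundedSobolevNormsOn (Icc 0 T'') u) →
      (∀ t ∈ Ico t₀ T, ∀ x, IsVorticityArgmax u t x → ε < (T - t) * ‖curl (u t) x‖ →
        (T - t) * netStretch ν u t x ≤ a * ‖curl (u t) x‖ ^ 2) →
      HasSobolevExtensionPast ν u T

/-! ## §3 Door S35-C «ArgmaxCoherenceDoor» -/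

/-- door S35-C «ArgmaxCoherenceDoor» (regularity criterion; Constantin–Fefferman at ONE point). There is a
universal `A ≥ 0` (the `C¹`-singular-kernel constant of `∇K`, `K` the Biot–Savart kernel; tree
`exists_isC1SingularKernel_biotSavartCLM`) such that: `ν > 0`, `0 ≤ t₀ < T`, `a < 1`, `0 < ε < √3/4`,
`(u,p)` in the frame; if at every late vorticity argmax `x̄` in the regime `(T − t)|ω(x̄,t)| > ε` the
DEPLETED majorant is `a`-subcritical —
`(T − t)·|ω(x̄)|²·(A ∫ |ω(y) − ⟪ω(y),ξ(x̄)⟫ξ(x̄)| |x̄−y|⁻³ dy − ν|∇ξ(x̄)|²_F) ≤ a|ω(x̄)|²` — then `u`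
continues past `T`. Coherence of the directions AS SEEN FROM THE ARGMAX (sine-weighted, `|y|⁻³`-weighted),
at one point per time; no modulus, no region. -/
def ArgmaxCoherenceDoor : Prop :=
  ∃ A : ℝ, 0 ≤ A ∧
  ∀ (ν T t₀ a ε : ℝ), 0 < ν → 0 ≤ t₀ → t₀ < T → a < 1 → 0 < ε → ε < Real.sqrt 3 / 4 →
    ∀ (u : ℝ → (EuclideanSpace ℝ (Fin 3)) → (EuclideanSpace ℝ (Fin 3)))
      (p : ℝ → (EuclideanSpace ℝ (Fin 3)) → ℝ),
      IsClassicalNSSolutionOn (Ico 0 T) ν 0 u p →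
      (∀ T'' < T, HasBoundedSobolevNormsOn (Icc 0 T'') u) →
      (∀ t ∈ Ico t₀ T, ∀ x, IsVorticityArgmax u t x → ε < (T - t) * ‖curl (u t) x‖ →
        (T - t) * (‖curl (u t) x‖ ^ 2 * (A * depletionIntegral u t x -
          ν * frobeniusNormSq (fderiv ℝ (vorticityDirection (curl (u t))) x))) ≤
          a * ‖curl (u t) x‖ ^ 2) →
      HasSobolevExtensionPast ν u T

/-! ## §4 Plates (solution-level statements; each provable in hours from tree tools) -/

/-- plate E «ArgmaxEngine» (S–M; = E1 ⊕ E2, the one-point parabolic maximum principle integrated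
by a weighted Friedman / first-touch argument; LEAD ns-s30-p1 g3's scratch
`norm_curl_le_mul_exp_of_argmax_rate_le` is the case `t₁ = 0` on a closed slab — this plate is its
time-translate). In the frame (`ν > 0`), on a slab `[t₁,t₂] ⊂ [0,T)`, let `Φ` be continuous on
`[t₁,t₂]` with one-sided derivative `φ(t)` within `[t₁,t₂]` at every `t`. If at every `t ∈ (t₁,t₂]`
and every vorticity argmax `x̄` with `ω(x̄,t) ≠ 0` the twist-credited stretching obeys
`⟪ω,(∇u)ω⟫ − ν|ω|²|∇ξ|²_F ≤ φ(t)|ω|²` at `(x̄,t)`, (stated as the LEAD typed it: `α − ν|∇ξ|²_F ≤ φ(t)`, `α = ⟪ξ,(∇u)ξ⟫`), then every bound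
`‖ω(t₁)‖_∞ ≤ M` propagates as `|ω(x,t)| ≤ M · e^{Φ(t) − Φ(t₁)}` for all `t ∈ [t₁,t₂]` and all `x`. Ingredients (all kernel-clean in the LEAD's scratch): E1 = `inner_vorticity_rhs_le_at_argmax`
(`⟪ω,∂ₜω⟫(x̄) ≤ (α − ν|∇ξ|²_F)|ω|²`: `⟪ω,(v·∇)ω⟫ = ½∂_v|ω|² = 0` and `⟪ω,Δω⟫ = |ω|(Δ|ω| − |ω||∇ξ|²_F) ≤
−|ω|²|∇ξ|²_F` at the maximum — `laplacian_norm_eq`, `laplacian_nonpos_of_isLocalMax_of_contDiffOn`,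
`stretching_eq_norm_smul`); E2 = `norm_le_mul_exp_of_argmax_inner_timeDeriv_le` (max of
`e^{−2Φ−2εt}|W|²` over the slab is attained by uniform decay `vorticity_uniform_decay`; one-sided Fermat);
time translation `u ↦ u(t₁ + ·)` as in A33/A34. -/
def ArgmaxEngine : Prop :=
  ∀ (ν T : ℝ) (u : ℝ → (EuclideanSpace ℝ (Fin 3)) → (EuclideanSpace ℝ (Fin 3)))
    (p : ℝ → (EuclideanSpace ℝ (Fin 3)) → ℝ), 0 < ν →
    IsClassicalNSSolutionOn (Ico 0 T) ν 0 u p →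
    (∀ T'' < T, HasBoundedSobolevNormsOn (Icc 0 T'') u) →
    ∀ (Φ φ : ℝ → ℝ) (t₁ t₂ M : ℝ), 0 ≤ t₁ → t₁ ≤ t₂ → t₂ < T → ContinuousOn Φ (Icc t₁ t₂) →
      (∀ t ∈ Icc t₁ t₂, HasDerivWithinAt Φ (φ t) (Icc t₁ t₂) t) →
      (∀ t ∈ Ioc t₁ t₂, ∀ x, IsVorticityArgmax u t x → curl (u t) x ≠ 0 →
        ⟪vorticityDirection (curl (u t)) x, fderiv ℝ (u t) x (vorticityDirection (curl (u t)) x)⟫ -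
          ν * frobeniusNormSq (fderiv ℝ (vorticityDirection (curl (u t))) x) ≤ φ t) →
      (∀ x, ‖curl (u t₁) x‖ ≤ M) →
      ∀ t ∈ Icc t₁ t₂, ∀ x, ‖curl (u t) x‖ ≤ M * Real.exp (Φ t - Φ t₁)

/-- plate Φ «PhaseLemma» (S; pure real analysis, no PDE). `t₀ < T`, `a < 1`, `ε > 0`, `m ≥ 0` continuous
on `[t₀,T)` with the SUBCRITICAL GROWTH LAW: `m(t₂) ≤ m(t₁)·((T−t₁)/(T−t₂))^a` on every slab `[t₁,t₂] ⊂ [t₀,T)`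
throughout whose half-open part `(t₁,t₂]` the phase `g(s) = (T−s)m(s)` exceeds `ε`. Then `g ≤ ε` on some
end-slab `[t₁,T)`. Proof: where `g > ε`, `g(t₂) ≤ g(t₁)((T−t₂)/(T−t₁))^{1−a}`; so (i) `g` cannot up-cross `ε`
(start the slab at the last time `τ` with `g(τ) ≤ ε`), and (ii) `g > ε` on all of `[t₀,T)` would force
`g → 0`. -/
def PhaseLemma : Prop :=
  ∀ (T t₀ a ε : ℝ) (m : ℝ → ℝ), t₀ < T → a < 1 → 0 < ε →
    ContinuousOn m (Ico t₀ T) → (∀ t ∈ Ico t₀ T, 0 ≤ m t) →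
    (∀ t₁ t₂ : ℝ, t₀ ≤ t₁ → t₁ ≤ t₂ → t₂ < T → (∀ s ∈ Ioc t₁ t₂, ε < (T - s) * m s) →
      m t₂ ≤ m t₁ * ((T - t₁) / (T - t₂)) ^ a) →
    ∃ t₁ ∈ Ico t₀ T, ∀ t ∈ Ico t₁ T, (T - t) * m t ≤ ε

/-- plate F «TypeISmallFloor» (XS; PROVED below from S33's closer by name). In the frame, if
`(T − t)‖ω(t)‖_∞ ≤ ε` on an end-slab `[t₁,T)` with `0 < ε < √3/4`, then `u` continues past `T`
(`criticalCoherenceDoor_holds` with an EMPTY intense set: the coherence hypothesis is vacuous). -/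
def TypeISmallFloor : Prop :=
  ∀ (ν T t₁ ε : ℝ), 0 < ν → 0 ≤ t₁ → t₁ < T → 0 < ε → ε < Real.sqrt 3 / 4 →
    ∀ (u : ℝ → (EuclideanSpace ℝ (Fin 3)) → (EuclideanSpace ℝ (Fin 3)))
      (p : ℝ → (EuclideanSpace ℝ (Fin 3)) → ℝ),
      IsClassicalNSSolutionOn (Ico 0 T) ν 0 u p →
      (∀ T'' < T, HasBoundedSobolevNormsOn (Icc 0 T'') u) →
      (∀ t ∈ Ico t₁ T, (T - t) * supVorticity u t ≤ ε) →
      HasSobolevExtensionPast ν u T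

/-- plate D «PointDepletion» (L; door C only; Constantin–Fefferman's depletion at ONE point for the class).
There is a universal `A ≥ 0` such that for every classical unforced solution in the frame, every
`t ∈ [0,T)` and every `x` with `ω(x,t) ≠ 0`: the depletion integrand is integrable and
`⟪ω,(∇u)ω⟫(x,t) ≤ A·|ω(x,t)|²·∫ |ω(y) − ⟪ω(y),ξ(x)⟫ξ(x)| |x−y|⁻³ dy`. Proof: `u(t) = K ∗ ω(t)`
(`biotSavart_curl_eq_self_of_integrable_sq`), smooth truncation `ω_R = χ_R ω` around `x`,
`exists_abs_inner_fderiv_biotSavart_le` (Lipschitz, compact support, `ω_R(x) ∥ ξ(x)`, majorant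
`A|ω(y) − ⟪ω(y),ξ(x)⟫ξ(x)||x−y|⁻³`), far field `∇(K ∗ (ω − ω_R))(x) → 0` (`ω ∈ L²`), `R → ∞`;
`⟪ω,(∇u)ω⟫ = |ω|²⟪ξ,(∇u)ξ⟫` (`stretching_eq_norm_smul`). -/
def PointDepletion : Prop :=
  ∃ A : ℝ, 0 ≤ A ∧
  ∀ (ν T : ℝ) (u : ℝ → (EuclideanSpace ℝ (Fin 3)) → (EuclideanSpace ℝ (Fin 3)))
    (p : ℝ → (EuclideanSpace ℝ (Fin 3)) → ℝ),
    IsClassicalNSSolutionOn (Ico 0 T) ν 0 u p →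
    (∀ T'' < T, HasBoundedSobolevNormsOn (Icc 0 T'') u) →
    ∀ t ∈ Ico 0 T, ∀ x, curl (u t) x ≠ 0 →
      Integrable (fun y => ‖curl (u t) y - ⟪curl (u t) y, vorticityDirection (curl (u t)) x⟫ •
          vorticityDirection (curl (u t)) x‖ * (‖x - y‖ ^ 3)⁻¹) ∧
      ⟪curl (u t) x, fderiv ℝ (u t) x (curl (u t) x)⟫ ≤
        A * ‖curl (u t) x‖ ^ 2 * depletionIntegral u t x

/-! ## §5 Helpers (proved) -/

section Helpers

variable {ν T : ℝ} {u : ℝ → (EuclideanSpace ℝ (Fin 3)) → (EuclideanSpace ℝ (Fin 3))}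
  {p : ℝ → (EuclideanSpace ℝ (Fin 3)) → ℝ}

/-- `0 ≤ ‖ω(t)‖_∞` (the supremum of a non-negative family, junk value `0` included). -/
theorem supVorticity_nonneg (u : ℝ → (EuclideanSpace ℝ (Fin 3)) → (EuclideanSpace ℝ (Fin 3))) (t : ℝ) :
    0 ≤ supVorticity u t :=
  ENNReal.toReal_nonneg

/-- In the frame the sup is finite below `T`, so `|ω(x,t)| ≤ ‖ω(t)‖_∞`. -/
theorem norm_curl_le_supVorticity (hsol : IsClassicalNSSolutionOn (Ico 0 T) ν 0 u p)
    (hreg : ∀ T'' < T, HasBoundedSobolevNormsOn (Icc 0 T'') u) {t : ℝ} (ht : t ∈ Ico 0 T)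
    (x : EuclideanSpace ℝ (Fin 3)) : ‖curl (u t) x‖ ≤ supVorticity u t := by
  obtain ⟨R, hRtop, hR⟩ := exists_enorm_curl_le_of_hasBoundedSobolevNormsOn (S := Icc 0 t)
    (fun s hs => hsol.contDiff_velocity ⟨hs.1, hs.2.trans_lt ht.2⟩) (hreg t ht.2)
  have hfin : (⨆ y, ‖curl (u t) y‖ₑ) ≠ ⊤ :=
    ne_top_of_le_ne_top hRtop.ne (iSup_le fun y => hR t ⟨ht.1, le_rfl⟩ y)
  unfold supVorticity
  rw [← ENNReal.ofReal_le_iff_le_toReal hfin, ofReal_norm]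
  exact le_iSup (fun y => ‖curl (u t) y‖ₑ) x

/-- At an argmax the sup norm is the value. -/
theorem supVorticity_eq_of_argmax {t : ℝ} {x : EuclideanSpace ℝ (Fin 3)} (hx : IsVorticityArgmax u t x) :
    supVorticity u t = ‖curl (u t) x‖ := by
  have h : (⨆ y, ‖curl (u t) y‖ₑ) = ‖curl (u t) x‖ₑ := by
    refine le_antisymm (iSup_le fun y => ?_) (le_iSup (fun y => ‖curl (u t) y‖ₑ) x)
    rw [← ofReal_norm, ← ofReal_norm]
    exact ENNReal.ofReal_le_ofReal (hx y)
  unfold supVorticity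
  rw [h, ← ofReal_norm, ENNReal.toReal_ofReal (norm_nonneg _)]

/-- A pointwise bound by a nonnegative real bounds the sup norm. -/
theorem supVorticity_le_of_forall_le {t b : ℝ} (hb : 0 ≤ b) (h : ∀ y, ‖curl (u t) y‖ ≤ b) :
    supVorticity u t ≤ b := by
  unfold supVorticity
  refine ENNReal.toReal_le_of_le_ofReal hb (iSup_le fun y => ?_)
  rw [← ofReal_norm]
  exact ENNReal.ofReal_le_ofReal (h y)

/-- `⟪ω,(∇u)ω⟫ − ν|ω|²|∇ξ|²_F = |ω|²·(α − ν|∇ξ|²_F)` with `α = ⟪ξ,(∇u)ξ⟫` (`ω = |ω|ξ`,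
tree `norm_smul_vorticityDirection`). Converts the doors' hypotheses into the engine's rate form. -/
theorem netStretch_eq (ν : ℝ) (u : ℝ → (EuclideanSpace ℝ (Fin 3)) → (EuclideanSpace ℝ (Fin 3)))
    (t : ℝ) (x : EuclideanSpace ℝ (Fin 3)) :
    netStretch ν u t x = ‖curl (u t) x‖ ^ 2 *
      (⟪vorticityDirection (curl (u t)) x, fderiv ℝ (u t) x (vorticityDirection (curl (u t)) x)⟫ -
        ν * frobeniusNormSq (fderiv ℝ (vorticityDirection (curl (u t))) x)) := by
  have h1 : ⟪curl (u t) x, fderiv ℝ (u t) x (curl (u t) x)⟫ = ‖curl (u t) x‖ ^ 2 *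
      ⟪vorticityDirection (curl (u t)) x, fderiv ℝ (u t) x (vorticityDirection (curl (u t)) x)⟫ := by
    conv_lhs => rw [← VorticityDirectionDynamics.norm_smul_vorticityDirection (curl (u t)) x]
    rw [real_inner_smul_left, ContinuousLinearMap.map_smul, real_inner_smul_right]
    ring
  unfold netStretch
  rw [h1]
  ring

/-- At a non-zero point, `netStretch ≤ c·|ω|²` iff the rate `α − ν|∇ξ|²_F ≤ c`. -/
theorem rate_le_of_netStretch_le {ν : ℝ} {u : ℝ → (EuclideanSpace ℝ (Fin 3)) → (EuclideanSpace ℝ (Fin 3))}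
    {t : ℝ} {x : EuclideanSpace ℝ (Fin 3)} {c : ℝ} (hne : curl (u t) x ≠ 0)
    (h : netStretch ν u t x ≤ c * ‖curl (u t) x‖ ^ 2) :
    ⟪vorticityDirection (curl (u t)) x, fderiv ℝ (u t) x (vorticityDirection (curl (u t)) x)⟫ -
        ν * frobeniusNormSq (fderiv ℝ (vorticityDirection (curl (u t))) x) ≤ c := by
  rw [netStretch_eq, mul_comm c] at h
  exact le_of_mul_le_mul_left h (pow_pos (norm_pos_iff.2 hne) 2)

/-- The integrating factor of door B: `Φ(s) = −a·log(T − s)` has `Φ' = a/(T − s)` on `s < T`. -/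
theorem hasDerivAt_neg_mul_log_sub (a : ℝ) {T s : ℝ} (hs : s < T) :
    HasDerivAt (fun r => -a * Real.log (T - r)) (a / (T - s)) s := by
  have hTs : T - s ≠ 0 := (sub_pos.2 hs).ne'
  have h1 : HasDerivAt (fun r => T - r) (-1) s := by
    simpa using (hasDerivAt_id s).const_sub T
  have h2 : HasDerivAt (fun r => Real.log (T - r)) ((T - s)⁻¹ * (-1)) s :=
    (Real.hasDerivAt_log hTs).comp s h1
  have h3 : HasDerivAt (fun r => -a * Real.log (T - r)) (-a * ((T - s)⁻¹ * (-1))) s :=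
    h2.const_mul (-a)
  have heq : -a * ((T - s)⁻¹ * (-1)) = a / (T - s) := by rw [div_eq_mul_inv]; ring
  exact h3.congr_deriv heq

/-- `exp(Φ(t₂) − Φ(t₁)) = ((T−t₁)/(T−t₂))^a` for `Φ = −a·log(T − ·)`, `t₁ ≤ t₂ < T`. -/
theorem exp_neg_mul_log_sub_sub (a : ℝ) {T t₁ t₂ : ℝ} (h₁₂ : t₁ ≤ t₂) (h₂ : t₂ < T) :
    Real.exp (-a * Real.log (T - t₂) - -a * Real.log (T - t₁)) = ((T - t₁) / (T - t₂)) ^ a := by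
  have hT₁ : 0 < T - t₁ := by linarith
  have hT₂ : 0 < T - t₂ := by linarith
  rw [Real.rpow_def_of_pos (div_pos hT₁ hT₂), Real.log_div hT₁.ne' hT₂.ne']
  congr 1
  ring

end Helpers

/-! ## §6 Compositions (kernel-checked) -/

/-- FLOOR (plate F) BY NAME from S33's closer: an empty intense set is vacuously coherent. -/
theorem typeISmallFloor_holds : TypeISmallFloor := by
  intro ν T t₁ ε hν ht₁ ht₁T hε hε' u p hsol hreg hsmall
  refine criticalCoherenceDoor_holds ν T t₁ ε 1 0 hν ht₁ ht₁T hε hε' one_pos u p hsol hreg ?_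
  intro t ht x y hx _
  exfalso
  have hle : ‖curl (u t) x‖ ≤ supVorticity u t :=
    norm_curl_le_supVorticity hsol hreg ⟨ht₁.trans ht.1, ht.2⟩ x
  have hTt : 0 ≤ T - t := by linarith [ht.2]
  have := mul_le_mul_of_nonneg_left hle hTt
  linarith [hsmall t ht]

/-- door A from the engine (+ Beale–Kato–Majda in the tree). -/
theorem argmaxIntegralDoor_of_engine (hE : ArgmaxEngine) : ArgmaxIntegralDoor := by
  intro ν T t₀ C Φ φ hν ht₀ ht₀T hΦc hΦd hC u p hsol hreg hhyp
  by_contra hmax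
  have hT : 0 < T := lt_of_le_of_lt ht₀ ht₀T
  -- the sup norm is bounded on `[t₀, T)`
  set M : ℝ := supVorticity u t₀ * Real.exp (C - Φ t₀) with hM
  have hbound : ∀ t ∈ Ico t₀ T, ∀ x, ‖curl (u t) x‖ ≤ M := by
    intro t ht x
    have hsub : Icc t₀ t ⊆ Ico t₀ T := Icc_subset_Ico_right ht.2
    have hcmp := hE ν T u p hν hsol hreg Φ φ t₀ t (supVorticity u t₀) ht₀ ht.1 ht.2 (hΦc.mono hsub)
      (fun s hs => (hΦd s (hsub hs)).mono hsub)
      (fun s hs y hy hy0 => rate_le_of_netStretch_le hy0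
        (hhyp s ⟨hs.1.le, lt_of_le_of_lt hs.2 ht.2⟩ y hy))
      (fun y => norm_curl_le_supVorticity hsol hreg ⟨ht₀, ht₀T⟩ y) t ⟨ht.1, le_rfl⟩ x
    calc ‖curl (u t) x‖ ≤ supVorticity u t₀ * Real.exp (Φ t - Φ t₀) := hcmp
      _ ≤ M := by
          rw [hM]
          exact mul_le_mul_of_nonneg_left (Real.exp_le_exp.2 (by linarith [hC t ht]))
            (supVorticity_nonneg u t₀)
  obtain ⟨t, ht, x, hx⟩ := exists_gt_norm_curl_of_not_hasSobolevExtensionPast hν.le hT hsol hreg hmax M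
    (t₀ := t₀) ⟨ht₀, ht₀T⟩
  exact (lt_irrefl M) (hx.trans_le (hbound t ⟨ht.1.le, ht.2⟩ x))

/-- door B from the engine + Φ + F (F proved above). -/
theorem argmaxSubcriticalDoor_of_plates (hE : ArgmaxEngine) (hΦ : PhaseLemma) (hF : TypeISmallFloor) :
    ArgmaxSubcriticalDoor := by
  intro ν T t₀ a ε hν ht₀ ht₀T ha hε hε' u p hsol hreg hhyp
  -- the subcritical growth law for `m = ‖ω(·)‖_∞` on slabs where the phase exceeds `ε`
  have hgrowth : ∀ t₁ t₂ : ℝ, t₀ ≤ t₁ → t₁ ≤ t₂ → t₂ < T →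
      (∀ s ∈ Ioc t₁ t₂, ε < (T - s) * supVorticity u s) →
      supVorticity u t₂ ≤ supVorticity u t₁ * ((T - t₁) / (T - t₂)) ^ a := by
    intro t₁ t₂ h₀₁ h₁₂ h₂T hphase
    -- integrating factor `Φ(s) = −a log(T − s)`, `Φ' = a/(T − s)` on the slab
    have hΦc : ContinuousOn (fun s => -a * Real.log (T - s)) (Icc t₁ t₂) := fun s hs =>
      (hasDerivAt_neg_mul_log_sub a (lt_of_le_of_lt hs.2 h₂T)).continuousAt.continuousWithinAt
    have hΦd : ∀ s ∈ Icc t₁ t₂,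
        HasDerivWithinAt (fun r => -a * Real.log (T - r)) (a / (T - s)) (Icc t₁ t₂) s := fun s hs =>
      (hasDerivAt_neg_mul_log_sub a (lt_of_le_of_lt hs.2 h₂T)).hasDerivWithinAt
    have hcmp := hE ν T u p hν hsol hreg (fun s => -a * Real.log (T - s)) (fun s => a / (T - s))
      t₁ t₂ (supVorticity u t₁) (ht₀.trans h₀₁) h₁₂ h₂T hΦc hΦd (fun s hs y hy hy0 => by
        have hs' : s < T := lt_of_le_of_lt hs.2 h₂T
        have hTs : 0 < T - s := sub_pos.2 hs'
        have hεs : ε < (T - s) * ‖curl (u s) y‖ := by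
          rw [← supVorticity_eq_of_argmax hy]; exact hphase s hs
        have hB := hhyp s ⟨h₀₁.trans (le_of_lt hs.1), hs'⟩ y hy hεs
        -- `(T - s) netStretch ≤ a |ω|²` ⇒ `netStretch ≤ (a/(T−s)) |ω|²` ⇒ rate `≤ a/(T−s)`
        refine rate_le_of_netStretch_le hy0 ?_
        rw [div_mul_eq_mul_div, le_div_iff₀ hTs, mul_comm]
        exact hB)
      (fun y => norm_curl_le_supVorticity hsol hreg ⟨ht₀.trans h₀₁, h₁₂.trans_lt h₂T⟩ y)
      t₂ ⟨h₁₂, le_rfl⟩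
    rw [exp_neg_mul_log_sub_sub a h₁₂ h₂T] at hcmp
    have hnn : 0 ≤ supVorticity u t₁ * ((T - t₁) / (T - t₂)) ^ a :=
      mul_nonneg (supVorticity_nonneg u t₁)
        (Real.rpow_nonneg (div_pos (by linarith) (by linarith)).le a)
    exact supVorticity_le_of_forall_le hnn hcmp
  -- the phase lemma
  have hcont : ContinuousOn (supVorticity u) (Ico t₀ T) :=
    (hsol.continuousOn_toReal_iSup_enorm_curl_Ico hreg).mono (Ico_subset_Ico_left ht₀)
  obtain ⟨t₁, ht₁, hsmall⟩ := hΦ T t₀ a ε (supVorticity u) ht₀T ha hε hcont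
    (fun t _ => supVorticity_nonneg u t) hgrowth
  -- the floor
  exact hF ν T t₁ ε hν (ht₀.trans ht₁.1) ht₁.2 hε hε' u p hsol hreg hsmall

/-- door B BY PLATES with the floor discharged: engine + Φ. -/
theorem argmaxSubcriticalDoor_of (hE : ArgmaxEngine) (hΦ : PhaseLemma) : ArgmaxSubcriticalDoor :=
  argmaxSubcriticalDoor_of_plates hE hΦ typeISmallFloor_holds

/-- door C from D + door B. -/
theorem argmaxCoherenceDoor_of (hD : PointDepletion) (hB : ArgmaxSubcriticalDoor) :
    ArgmaxCoherenceDoor := by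
  obtain ⟨A, hA, hdep⟩ := hD
  refine ⟨A, hA, ?_⟩
  intro ν T t₀ a ε hν ht₀ ht₀T ha hε hε' u p hsol hreg hhyp
  refine hB ν T t₀ a ε hν ht₀ ht₀T ha hε hε' u p hsol hreg fun t ht x hx hεx => ?_
  have hTt : 0 < T - t := sub_pos.2 ht.2
  have hx0 : curl (u t) x ≠ 0 := by
    intro h0
    rw [h0, norm_zero, mul_zero] at hεx
    exact (lt_irrefl _) (hεx.trans hε)
  obtain ⟨-, hle⟩ := hdep ν T u p hsol hreg t ⟨ht₀.trans ht.1, ht.2⟩ x hx0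
  have hnet : netStretch ν u t x ≤ ‖curl (u t) x‖ ^ 2 * (A * depletionIntegral u t x -
      ν * frobeniusNormSq (fderiv ℝ (vorticityDirection (curl (u t))) x)) := by
    unfold netStretch
    nlinarith [hle]
  exact (mul_le_mul_of_nonneg_left hnet hTt.le).trans (hhyp t ht x hx hεx)

/-- door C BY PLATES: D + engine + Φ. -/
theorem argmaxCoherenceDoor_of_plates (hD : PointDepletion) (hE : ArgmaxEngine) (hΦ : PhaseLemma) :
    ArgmaxCoherenceDoor :=
  argmaxCoherenceDoor_of hD (argmaxSubcriticalDoor_of hE hΦ)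

end Summit.NavierStokesRegularity.NavierStokesRegularity.Theorems.ArgmaxDoors

end
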